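import Mathlib
import Literature.MathematicalPhysics.QuantumFieldTheory.Balaban1983to89.B4Sect5Proof
import Literature.MathematicalPhysics.QuantumFieldTheory.Balaban1983to89.B6WeightedEncoding

/-!
# `Balaban1983to89.B6Sect5Closed` — the five use sites of "[3], Sect. 5" in B6, UNCONDITIONAL

B6 = T. Bałaban, *Propagators and renormalization transformations for lattice gauge theories. II*, Commun. Math.
Phys. **96**, 223–250 (1984) [Balaban1984PropagatorsII]; its reference [3] = B4 = T. Bałaban, *Regularity and decay
of lattice Green's functions*, Commun. Math. Phys. **89** (1983) 571–597 [Balaban1983RegularityDecay], Sect. 5 Theorem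
p. 594.  Read from the ×2 page renders (journal page = PDF page + 222;
`run/shared/lean/pub/pub-balaban/b2b-balaban-ref1/pages/1984-cmp96-propagators-rt-II/…-p015-x2.png` (p. 237),
`…-p020-x2.png` (p. 242), `…-p024-x2.png` (p. 246), `…-p026-x2.png`–`…-p028-x2.png` (pp. 248–250)).

CITATION HEADER (lean-in-tree rule 2026-08-18).  Cell `pub-balaban`, unit `b2b-balaban-b06-g4` (paper sub-cell B06,
gen 4; journal claim B6-SECT5-DISCHARGE).  Sibling of the landed B6 use-site modules `…B6FromB4` (unit pv09-g2),
`…B6Elimination` / `…B6BondElimination` / `…B6WeightedEncoding` (units b06-g2 / b06-g3) and of `…B4Sect5Proof` (unit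
pv23-g3), which PROVES the leaf `B4.Sect5ThmUniform d N` (`B4Sect5Proof.sect5ThmUniform_holds`).  Nothing landed is
edited; everything is imported and used BY NAME.

## The printed use sites (verbatim)

* (S1) p. 237: *"We can use the theory developed in Sect. 5 [3] to conclude that it has an exponential decay with a
  decay rate δ₁ depending on δ₀ and the bound γ₀."* — (2.79), (2.81).
* (S2) p. 242: *"with positive constants γ₀, γ₁ dependent on d and L only. From the theorem on unit lattice operators
  in [3] it follows that a covariance C′^{(j)}_Λ of the last Gaussian integrals in (2.106) is a bounded operator with
  an exponential decay independent of j and Λ."*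
* (S3) p. 246: *"This implies that a covariance C̃^{(j)}_Λ of the Gaussian integral in (2.119) is bounded from above by
  a positive constant dependent on d and L only, and it has an exponential decay with a decay rate having the same
  property."*
* (S4) pp. 248–249: (2.147) ⟹ (2.148).
* (S5) p. 250: *"C is a short-ranged operator, so C*Δ_kC has the same exponential decay as Δ_k. Now we may apply the
  theory developed in Sect. 5 of [3] on unit lattice operators. It gives us an exponential decay, and all the other
  properties, for the operator (C*Δ_kC)⁻¹, hence for C^{(k)}_Λ also."*

## What this module does

Every landed use-site theorem of the four sibling modules consumes the Sect. 5 Theorem of [3] as a NAMED HYPOTHESIS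
`(h5 : B4.Sect5ThmUniform d _)` (uniform reading; census C-B4-3).  Since `…B4Sect5Proof` (2026-08-18) that Prop is a
kernel-checked theorem for all `d, N`; `…B4Sect5Proof` itself already records the two consumer corollaries
`unitLatticeEngine : B6FromB4.UnitLatticeEngine d N` and `cutFamilyUniform : B6GOmega.CutFamilyUniform d N`.  This
module records the remaining ones — the SAME statements with the binder `h5` removed, each a one-line application of
the landed theorem to `B4Sect5Proof.sect5ThmUniform_holds d _`:

| here | landed conditional theorem | site |
|---|---|---|
| `reductions` | `B6FromB4.reductions_uniform` | (S2), (S3), (S5) generic |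
| `useSites`, `cubeSites` | `B6FromB4.useSites_uniform`, `B6FromB4.cubeSites_uniform` | (S1), (S4) generic |
| `ineq279_281`, `ineq2148` | `B6FromB4.ineq279_281_of_sect5`, `B6FromB4.ineq2148_of_sect5` | (S1), (S4) |
| `site242`, `site242_region` | `B6Elimination.site242_uniform`, `…site242_uniform_region` | (S2) |
| `subReductions`, `bond250` | `B6BondElimination.subReductions_uniform`, `…bond250_uniform` | (S5) |
| `weightedSites`, `weightedSites_kernel` | `B6WeightedEncoding.weightedSites_uniform(_kernel)` | (S1), (S4) encoded |
| `ineq279_281_weighted`, `ineq2148_weighted` | `B6WeightedEncoding.ineq279_281_of_weighted`, `…ineq2148_of_weighted` | (S1), (S4) encoded |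

So, e.g., `bond250` says WITHOUT ANY HYPOTHESIS ON [3]: for (d, L, γ, c₀, δ₀) there are ONE c and ONE δ such that for
every finite Ω ⊂ ℤ^d, every admissible constraint data (K, Y) and every symmetric Δ_k on the bond variables of Ω with
kernel ≤ c₀e^{−δ₀|b₋−b′₋|} and the lower bound (2.153) on the constrained subspace, the covariance (2.156)
C^{(k)}_Λ = C(C*Δ_kC)⁻¹C* obeys |C^{(k)}_Λ(b, b′)| ≤ c·e^{−δ|b₋−b′₋|}.

## What remains hypothesis at these sites (unchanged; NOT touched here)

Exactly the site-specific PRINTED inputs that the sibling modules keep as binders: the lower bounds (2.78) / (2.110) /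
p. 246 / (2.147) / (2.153) and the asserted kernel decays of the operators to which [3] is applied (fields of
`Reduction.Printed`, `SubReduction.Printed`, `WSite.Printed`, `B4.Hyp56`, `LowerOnKer`, `LowerOnConstrained`), the
scaling laws (2.80) / (2.144) (`ht`, `h280`, `h2144`), and — for (S5) on the tori T^{(k)}_η of (2.152) — the typing of
the bond sets as finite regions of ℤ^d (cell DIVERGENCE D-pv09g2.2 / D-b06.10–12; the torus variant of [3] is GAPS row
G-pv09g2-1 (vi), not addressed by this module).  "All the other properties" of p. 250 ((5.8), (5.10) of [3]) are
available unconditionally through `B4Sect5Proof.sect5_explicit` / `cutFamilyUniform` and are not restated.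

Value = kernel edges (unconditional forms of already-landed conditional theorems; the discharge of one published,
now kernel-proved, hypothesis at its B6 use sites), NOT summit progress.
-/

namespace Literature.MathematicalPhysics.QuantumFieldTheory.Balaban1983to89.B6Sect5Closed

open Literature.MathematicalPhysics.QuantumFieldTheory.Balaban1983to89
open Finset
open scoped Matrix

/-! ## §1  The generic use-site theorems of `…B6FromB4`, unconditional -/

section FromB4

variable {d N N' : ℕ}

/-- (S2)/(S3)/(S5) generic, UNCONDITIONAL: there are ONE c and ONE δ such that EVERY constrained-Gaussian reduction
instance with the printed-shape inputs (γ, c₀, δ₀, r, m) has |cov(x, x′)| ≤ c·e^{−δ|x−x′|}, cov = C(C*ΔC)⁻¹C* (2.156).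
= `B6FromB4.reductions_uniform` with `h5` discharged by `B4Sect5Proof.sect5ThmUniform_holds d N'`.
[cite: Balaban1984PropagatorsII, (2.110) p.242 + p.246 + (2.153)–(2.157) pp.249–250] -/
theorem reductions {γ c₀ δ₀ r mC : ℝ} (hγ : 0 < γ) (hc : 0 < c₀) (hδ : 0 < δ₀) (hm : 0 < mC) :
    ∃ c δ : ℝ, 0 < c ∧ 0 < δ ∧ ∀ T : B6FromB4.Reduction d N N', T.Printed γ c₀ δ₀ r mC →
      ∀ p q : B4.Idx T.Ω N,
        |T.cov p q| ≤ c * Real.exp (-(δ * dist (p.1 : Fin d → ℤ) (q.1 : Fin d → ℤ))) :=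
  B6FromB4.reductions_uniform (B4Sect5Proof.sect5ThmUniform_holds d N') hγ hc hδ hm

/-- (S1)/(S4) generic, UNCONDITIONAL: ONE O(1) and ONE rate for every use site whose encoded operator satisfies (5.6)
with (γ₀, c₀, δ₀) and whose encoding has constants (K, σ): |ker(y, y′)| ≤ O(1)e^{−δρ(y,y′)} — p. 237 *"a decay rate δ₁
depending on δ₀ and the bound γ₀"*.  = `B6FromB4.useSites_uniform` with `h5` discharged.
[cite: Balaban1984PropagatorsII, (2.79) p.237] -/
theorem useSites {γ₀ c₀ δ₀ K σ : ℝ} (hγ : 0 < γ₀) (hc : 0 < c₀) (hδ : 0 < δ₀) (hK : 0 ≤ K) (hσ : 0 < σ) :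
    ∃ C δ : ℝ, 0 < C ∧ 0 < δ ∧ ∀ U : B6FromB4.UseSite d N, B4.Hyp56 U.Ω U.A γ₀ c₀ δ₀ → U.Encodes K σ →
      ∀ y y', |U.ker y y'| ≤ C * Real.exp (-(δ * U.ρ y y')) :=
  B6FromB4.useSites_uniform (B4Sect5Proof.sect5ThmUniform_holds d N) hγ hc hδ hK hσ

/-- The generic cube-site family bound (scaling exponent e), UNCONDITIONAL.  = `B6FromB4.cubeSites_uniform` with `h5`
discharged. [cite: Balaban1984PropagatorsII, (2.79)–(2.81) p.237 + (2.148) p.249] -/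
theorem cubeSites {I : Type} (e : ℝ) (fam : I → B6FromB4.CubeSite d N)
    {γ c₀ δ₀ K σ : ℝ} (hγ : 0 < γ) (hc : 0 < c₀) (hδ : 0 < δ₀) (hK : 0 ≤ K) (hσ : 0 < σ)
    (h56 : ∀ i, B4.Hyp56 (fam i).Ω (fam i).A γ c₀ δ₀)
    (henc : ∀ i, (fam i).toUseSite.Encodes K σ)
    (ht : ∀ i, 0 < (fam i).t)
    (hscale : ∀ i y y', (fam i).kerCube y y' = (fam i).t ^ (-e) * (fam i).ker y y') :
    ∃ C δ : ℝ, 0 < C ∧ 0 < δ ∧ B6FromB4.ScaledFamilyBound e fam C δ :=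
  B6FromB4.cubeSites_uniform (B4Sect5Proof.sect5ThmUniform_holds d N) e fam hγ hc hδ hK hσ h56 henc ht hscale

/-- (S1) UNCONDITIONAL in [3]: (2.78) instances of (5.6) + encodings + the scaling law (2.80) ⟹ (2.79) ∧ (2.81) with
ONE O(1), ONE δ₁ for the whole family of (geometry, j, □).  = `B6FromB4.ineq279_281_of_sect5` with `h5` discharged.
[cite: Balaban1984PropagatorsII, (2.78)–(2.81) pp.236–237] -/
theorem ineq279_281 {I : Type} (fam : I → B6FromB4.CubeSite d N)
    {γ₀ c₀ δ₀ K σ : ℝ} (hγ : 0 < γ₀) (hc : 0 < c₀) (hδ : 0 < δ₀) (hK : 0 ≤ K) (hσ : 0 < σ)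
    (h278 : ∀ i, B4.Hyp56 (fam i).Ω (fam i).A (γ₀ ^ 2) c₀ δ₀)
    (henc : ∀ i, (fam i).toUseSite.Encodes K σ)
    (ht : ∀ i, 0 < (fam i).t)
    (h280 : ∀ i y y', (fam i).kerCube y y' = (fam i).t ^ (-((d : ℝ) + 4)) * (fam i).ker y y') :
    ∃ C δ₁ : ℝ, 0 < C ∧ 0 < δ₁ ∧ B6FromB4.Ineq279_281 fam C δ₁ :=
  B6FromB4.ineq279_281_of_sect5 (B4Sect5Proof.sect5ThmUniform_holds d N) fam hγ hc hδ hK hσ h278 henc ht h280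

/-- (S4) UNCONDITIONAL in [3]: (2.147) instances of (5.6) + encodings + the bond scaling law (2.144) ⟹ (2.148) with ONE
O(1), ONE δ₄ for the whole family.  = `B6FromB4.ineq2148_of_sect5` with `h5` discharged.
[cite: Balaban1984PropagatorsII, (2.144)–(2.148) pp.248–249] -/
theorem ineq2148 {I : Type} (fam : I → B6FromB4.CubeSite d N)
    {γ₀ c₀ δ₀ K σ : ℝ} (hγ : 0 < γ₀) (hc : 0 < c₀) (hδ : 0 < δ₀) (hK : 0 ≤ K) (hσ : 0 < σ)
    (h2147 : ∀ i, B4.Hyp56 (fam i).Ω (fam i).A γ₀ c₀ δ₀)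
    (henc : ∀ i, (fam i).toUseSite.Encodes K σ)
    (ht : ∀ i, 0 < (fam i).t)
    (h2144 : ∀ i y y', (fam i).kerCube y y' = (fam i).t ^ (-((d : ℝ) + 2)) * (fam i).ker y y') :
    ∃ C δ₄ : ℝ, 0 < C ∧ 0 < δ₄ ∧ B6FromB4.Ineq2148 fam C δ₄ :=
  B6FromB4.ineq2148_of_sect5 (B4Sect5Proof.sect5ThmUniform_holds d N) fam hγ hc hδ hK hσ h2147 henc ht h2144

end FromB4

/-! ## §2  (S2) p. 242: the covariance C′^{(j)}_Λ of (2.106)/(2.110), unconditional -/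

section Site242

variable {d L : ℕ}

/-- (S2) UNCONDITIONAL in [3] — p. 242: *"From the theorem on unit lattice operators in [3] it follows that a covariance
C′^{(j)}_Λ of the last Gaussian integrals in (2.106) is a bounded operator with an exponential decay independent of j
and Λ."*  Given (d, L, γ₀, c₀, δ₀) there are ONE c and ONE δ such that for EVERY union of blocks Λ and EVERY symmetric
Δ on L²(Λ) with |Δ(y, y′)| ≤ c₀e^{−δ₀|y−y′|} and γ₀‖ω‖² ≤ ⟨ω, Δω⟩ on ker Q′₁ ((2.110)), the covariance of the constrained
Gaussian obeys |C′(y, y′)| ≤ c·e^{−δ|y−y′|}.  = `B6Elimination.site242_uniform` with `h5` discharged by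
`B4Sect5Proof.sect5ThmUniform_holds d 1`. [cite: Balaban1984PropagatorsII, (2.110) p.242] -/
theorem site242 (hL : 0 < L) {γ₀ c₀ δ₀ : ℝ} (hγ : 0 < γ₀) (hc : 0 < c₀) (hδ : 0 < δ₀) :
    ∃ c δ : ℝ, 0 < c ∧ 0 < δ ∧ ∀ (Λ : Finset (Fin d → ℤ)), B6Elimination.BlockClosed L Λ →
      ∀ Δ : Matrix (B4.Idx Λ 1) (B4.Idx Λ 1) ℝ, Δ.IsSymm → B6Elimination.KernelDecay Λ Δ c₀ δ₀ →
        B6Elimination.LowerOnKer L Λ Δ γ₀ →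
        ∀ p q : B4.Idx Λ 1, |(B6Elimination.kerReduction L Λ Δ).cov p q| ≤
          c * Real.exp (-(δ * dist (p.1 : Fin d → ℤ) (q.1 : Fin d → ℤ))) :=
  B6Elimination.site242_uniform (B4Sect5Proof.sect5ThmUniform_holds d 1) hL hγ hc hδ

/-- (S2) UNCONDITIONAL, for the regions Λ = ⋃_{y∈Λ′} B(y) of (2.89).  = `B6Elimination.site242_uniform_region` with `h5`
discharged. [cite: Balaban1984PropagatorsII, (2.89) p.239 + (2.110) p.242] -/
theorem site242_region (hL : 0 < L) {γ₀ c₀ δ₀ : ℝ} (hγ : 0 < γ₀) (hc : 0 < c₀) (hδ : 0 < δ₀) :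
    ∃ c δ : ℝ, 0 < c ∧ 0 < δ ∧ ∀ (Λ' : Finset (Fin d → ℤ))
      (Δ : Matrix (B4.Idx (B6Elimination.region L Λ') 1) (B4.Idx (B6Elimination.region L Λ') 1) ℝ),
        Δ.IsSymm → B6Elimination.KernelDecay (B6Elimination.region L Λ') Δ c₀ δ₀ →
        B6Elimination.LowerOnKer L (B6Elimination.region L Λ') Δ γ₀ →
        ∀ p q : B4.Idx (B6Elimination.region L Λ') 1,
          |(B6Elimination.kerReduction L (B6Elimination.region L Λ') Δ).cov p q| ≤
            c * Real.exp (-(δ * dist (p.1 : Fin d → ℤ) (q.1 : Fin d → ℤ))) :=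
  B6Elimination.site242_uniform_region (B4Sect5Proof.sect5ThmUniform_holds d 1) hL hγ hc hδ

end Site242

/-! ## §3  (S5) p. 250: the covariance C^{(k)}_Λ = C(C*Δ_kC)⁻¹C* of (2.156), unconditional -/

section Site250

variable {d N L : ℕ}

/-- (S5) generic sub-family form, UNCONDITIONAL in [3]: ONE c and ONE δ for ALL instances `SubReduction` (region Ω,
kept sub-family F, symmetric Δ, parametrization C) with the printed-shape inputs (γ, c₀, δ₀, r, m).
= `B6BondElimination.subReductions_uniform` with `h5` discharged. [cite: Balaban1984PropagatorsII, (2.153)–(2.157) pp.249–250] -/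
theorem subReductions {γ c₀ δ₀ r mC : ℝ} (hγ : 0 < γ) (hc : 0 < c₀) (hδ : 0 < δ₀) (hm : 0 < mC) :
    ∃ c δ : ℝ, 0 < c ∧ 0 < δ ∧ ∀ T : B6BondElimination.SubReduction d N, T.Printed γ c₀ δ₀ r mC →
      ∀ p q : B4.Idx T.Ω N,
        |T.cov p q| ≤ c * Real.exp (-(δ * dist (p.1 : Fin d → ℤ) (q.1 : Fin d → ℤ))) :=
  B6BondElimination.subReductions_uniform (B4Sect5Proof.sect5ThmUniform_holds d N) hγ hc hδ hm

/-- (S5) UNCONDITIONAL in [3] — the sentence of p. 250 *"Now we may apply the theory developed in Sect. 5 of [3] on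
unit lattice operators. It gives us an exponential decay, and all the other properties, for the operator (C*Δ_kC)⁻¹,
hence for C^{(k)}_Λ also."* with NO hypothesis on [3] left: for (d, L, γ, c₀, δ₀) there are ONE c and ONE δ — chosen
BEFORE the region, the constraint data and the operator — such that for EVERY finite Ω ⊂ ℤ^d, EVERY admissible (K, Y)
and EVERY symmetric Δ on the bond variables of Ω with |Δ(b, b′)| ≤ c₀e^{−δ₀|b₋−b′₋|} and (2.153) with constant γ on
{QB = 0, B(Γ_{y,x}) = 0}, |C^{(k)}_Λ(b, b′)| ≤ c·e^{−δ|b₋−b′₋|} for the covariance (2.156).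
= `B6BondElimination.bond250_uniform` with `h5` discharged by `B4Sect5Proof.sect5ThmUniform_holds d d`.
[cite: Balaban1984PropagatorsII, (2.153)–(2.157) pp.249–250] -/
theorem bond250 (hL : 0 < L) {γ c₀ δ₀ : ℝ} (hγ : 0 < γ) (hc : 0 < c₀) (hδ : 0 < δ₀) :
    ∃ c δ : ℝ, 0 < c ∧ 0 < δ ∧
      ∀ (Ω : Finset (Fin d → ℤ)) (K : Finset ((Fin d → ℤ) × Fin d)) (Y : Finset (Fin d → ℤ)),
        B6BondElimination.Admissible L Ω K → ∀ Δ : Matrix (B4.Idx Ω d) (B4.Idx Ω d) ℝ, Δ.IsSymm →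
        (∀ p q : B4.Idx Ω d, |Δ p q| ≤ c₀ * Real.exp (-(δ₀ * dist (p.1 : Fin d → ℤ) (q.1 : Fin d → ℤ)))) →
        B6BondElimination.LowerOnConstrained L K Y Δ γ →
        ∀ p q : B4.Idx Ω d, |(B6BondElimination.bondReduction L Ω K Y Δ).cov p q| ≤
          c * Real.exp (-(δ * dist (p.1 : Fin d → ℤ) (q.1 : Fin d → ℤ))) :=
  B6BondElimination.bond250_uniform (B4Sect5Proof.sect5ThmUniform_holds d d) hL hγ hc hδ

end Site250

/-! ## §4  (S1)/(S4) with the weighted encoding of `…B6WeightedEncoding` performed, unconditional -/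

section Weighted

variable {d N : ℕ}

/-- UNCONDITIONAL in [3]: ONE O(1) and ONE rate δ such that for EVERY weighted site with the printed hypotheses
(W, γ₀, c₀, δ₀) the inverse operator decays, |M⁻¹(y, y′)| ≤ O(1)e^{−δ|ιy − ιy′|} — p. 237 with neither the encoding
nor [3] a hypothesis.  = `B6WeightedEncoding.weightedSites_uniform` with `h5` discharged.
[cite: Balaban1984PropagatorsII, p.237 + p.248] -/
theorem weightedSites {W γ₀ c₀ δ₀ : ℝ} (hγ : 0 < γ₀) (hc : 0 ≤ c₀) (hδ : 0 < δ₀) :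
    ∃ C δ : ℝ, 0 < C ∧ 0 < δ ∧ ∀ U : B6WeightedEncoding.WSite d N, U.Printed W γ₀ c₀ δ₀ →
      ∀ y y', |U.M⁻¹ y y'| ≤
        C * Real.exp (-(δ * dist ((U.ι y).1 : Fin d → ℤ) ((U.ι y').1 : Fin d → ℤ))) :=
  B6WeightedEncoding.weightedSites_uniform (B4Sect5Proof.sect5ThmUniform_holds d N) hγ hc hδ

/-- The same in B6's weighted-measure kernel convention (kernel = matrix entry / w(y′)).
= `B6WeightedEncoding.weightedSites_uniform_kernel` with `h5` discharged. [cite: Balaban1984PropagatorsII, (2.83) p.237] -/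
theorem weightedSites_kernel {W γ₀ c₀ δ₀ : ℝ} (hγ : 0 < γ₀) (hc : 0 ≤ c₀) (hδ : 0 < δ₀) :
    ∃ C δ : ℝ, 0 < C ∧ 0 < δ ∧ ∀ U : B6WeightedEncoding.WSite d N, U.Printed W γ₀ c₀ δ₀ →
      ∀ y y', |U.M⁻¹ y y' / U.w y'| ≤
        C * Real.exp (-(δ * dist ((U.ι y).1 : Fin d → ℤ) ((U.ι y').1 : Fin d → ℤ))) :=
  B6WeightedEncoding.weightedSites_uniform_kernel (B4Sect5Proof.sect5ThmUniform_holds d N) hγ hc hδ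

/-- (S1) with the encoding performed AND [3] discharged: the printed weighted hypotheses ((2.78) in the product (2.69),
weights in [1, W], asserted kernel decay) + the scaling law (2.80) ⟹ (2.79) ∧ (2.81), ONE O(1), ONE δ₁ for the family.
= `B6WeightedEncoding.ineq279_281_of_weighted` with `h5` discharged. [cite: Balaban1984PropagatorsII, (2.78)–(2.81) pp.236–237] -/
theorem ineq279_281_weighted {I : Type} (fam : I → B6WeightedEncoding.WCubeSite d N)
    {W γ₀ c₀ δ₀ : ℝ} (hγ : 0 < γ₀) (hc : 0 ≤ c₀) (hδ : 0 < δ₀)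
    (h278 : ∀ i, (fam i).toWSite.Printed W (γ₀ ^ 2) c₀ δ₀)
    (ht : ∀ i, 0 < (fam i).t)
    (h280 : ∀ i y y', (fam i).kerCube y y' = (fam i).t ^ (-((d : ℝ) + 4)) * (fam i).M⁻¹ y y') :
    ∃ C δ₁ : ℝ, 0 < C ∧ 0 < δ₁ ∧
      B6FromB4.Ineq279_281 (fun i => (fam i).toCubeSite (γ₀ ^ 2)) C δ₁ :=
  B6WeightedEncoding.ineq279_281_of_weighted (B4Sect5Proof.sect5ThmUniform_holds d N) fam hγ hc hδ h278 ht h280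

/-- (S4) with the encoding performed AND [3] discharged: the printed weighted hypotheses ((2.147), asserted kernel
decay) + the bond scaling law (2.144) ⟹ (2.148), ONE O(1), ONE δ₄ for the family.
= `B6WeightedEncoding.ineq2148_of_weighted` with `h5` discharged. [cite: Balaban1984PropagatorsII, (2.144)–(2.148) pp.248–249] -/
theorem ineq2148_weighted {I : Type} (fam : I → B6WeightedEncoding.WCubeSite d N)
    {W γ₀ c₀ δ₀ : ℝ} (hγ : 0 < γ₀) (hc : 0 ≤ c₀) (hδ : 0 < δ₀)
    (h2147 : ∀ i, (fam i).toWSite.Printed W γ₀ c₀ δ₀)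
    (ht : ∀ i, 0 < (fam i).t)
    (h2144 : ∀ i y y', (fam i).kerCube y y' = (fam i).t ^ (-((d : ℝ) + 2)) * (fam i).M⁻¹ y y') :
    ∃ C δ₄ : ℝ, 0 < C ∧ 0 < δ₄ ∧
      B6FromB4.Ineq2148 (fun i => (fam i).toCubeSite γ₀) C δ₄ :=
  B6WeightedEncoding.ineq2148_of_weighted (B4Sect5Proof.sect5ThmUniform_holds d N) fam hγ hc hδ h2147 ht h2144

end Weighted

/-! ## §5  Ledger of this module (cell GAPS / DIVERGENCE)

* Every B6 use site of [3] Sect. 5 typed in the tree ((S1)–(S5): `…B6FromB4`, `…B6Elimination`, `…B6BondElimination`,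
  `…B6WeightedEncoding`; and, in `…B4Sect5Proof`, `…B6GOmega`'s cut family and the engine) now has an UNCONDITIONAL
  form as far as [3] is concerned.  `#print axioms` of every theorem here: propext, Classical.choice, Quot.sound.
* NOT touched (still binders / located residuals of the sibling modules): the printed lower bounds and asserted kernel
  decays at each site, the scaling laws, the torus-vs-ℤ^d typing of (S5) (GAPS G-pv09g2-1 (vi)).
-/

end Literature.MathematicalPhysics.QuantumFieldTheory.Balaban1983to89.B6Sect5Closed
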